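import Mathlib
import HarnessLib
import Literature.Analysis.FluidPDE.SelfSimilar
import Literature.Analysis.FluidPDE.Vorticity
import Literature.Analysis.FluidPDE.VorticityEquation
import Literature.Analysis.FluidPDE.SpaceTimeCalculus
import Literature.Analysis.FluidPDE.ElgindiBlowup
import Literature.Analysis.FluidPDE.VeryWeakToDistributional
import Summits.NavierStokesRegularity.NavierStokesRegularity.Theorems.HalfSpaceWindowDoorCirculationCarryingRigidityDefs
import Summits.NavierStokesRegularity.NavierStokesRegularity.Theorems.ChiralWindowDoorClassDerivDecay
import Summits.NavierStokesRegularity.NavierStokesRegularity.Theorems.CorkscrewDynamoCorkscrewProfileAncientSubsolutionLiouville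
import Summits.NavierStokesRegularity.NavierStokesRegularity.Theorems.PoloidalWindowDoorPoloidalWindowRigidityClassSpaceTimeRates

/-!
# Route `HalfSpaceWindowDoor`, crux `CirculationCarryingRigidity` (stmt-NavierStokesRegularity-25311) —
# SUBCRITICAL `e₃`-STRETCHING EXCLUSION: a closed-hemisphere Type-I profile whose `e₃`-vorticity is stretched
# below the similarity rate is poloidal

The open research stub of the skeleton of record is `StubLayerExclusion ≡ HemisphereLiouvilleE3`
(`…Reduction.stubLayerExclusion_iff_hemisphereLiouvilleE3`): closed-hemisphere profiles of the route's Type-I ancient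
Oseen-mild class (`⟪curl v, e₃⟫ ≥ 0`) have `⟪curl v, e₃⟫ ≡ 0`.  The `e₃`-vorticity `ω₃ = ⟪curl v, e₃⟫` of a profile
obeys (vorticity formulation, `…VorticityEquation`)

  `∂ₜω₃ + v·∇ω₃ − Δω₃ = ⟪(ω·∇)v, e₃⟫ = (ω·∇)v₃`   (`hasDerivAt_inner_curl_e3`),

so the ONLY obstruction to the maximum-principle Liouville argument (ancient subsolutions with Type-I drift and
Type-I decay die, tree `…CorkscrewProfile.Birth.stub_ancientSubsolutionNonpos`) is the STRETCHING SOURCE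
`(ω·∇)v₃`, of critical size `O((−t)^{−2}) = O(ω₃/(−t))`.  This file proves the sharp-rate stratum:

* `inner_curl_e3_nonpos_of_subcritical_stretching` — for ANY profile of the class (no sign hypothesis): if for some
  `θ < 1` the `e₃`-stretching obeys `(−s)·⟪Dv(s,y)[curl v(s,y)], e₃⟫ ≤ θ·⟪curl v(s,y), e₃⟫` for all `s < 0`, `y`,
  then `⟪curl v(s,y), e₃⟫ ≤ 0` everywhere (`w = (−s)^θ ω₃` is an ancient subsolution of `∂ₛw ≤ Δw − v·∇w`,
  `w ≤ 4K(−s)^{θ−1} → 0` as `s → −∞` by the class rate `‖∇v(s)‖ ≤ K/(−s)`; `θ < 1` is used exactly here);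
* `inner_curl_e3_eq_zero_of_subcritical_stretching` — **the stratum theorem**: a CLOSED-HEMISPHERE profile
  (`⟪curl v, e₃⟫ ≥ 0`) with subcritical `e₃`-stretching is poloidal along `e₃` (`⟪curl v, e₃⟫ ≡ 0`), i.e.
  `HemisphereLiouvilleE3` holds on this stratum;
* `exists_supercritical_stretching_of_pos` — contrapositive, census form: a circulation-carrying closed-hemisphere
  profile (`⟪curl v(s₀,y₀), e₃⟫ > 0` somewhere) stretches its `e₃`-vorticity AT LEAST AT THE SIMILARITY RATE somewhere:
  for every `θ < 1` there are `s < 0`, `y` with `θ·⟪curl v(s,y), e₃⟫ < (−s)·⟪Dv(s,y)[curl v(s,y)], e₃⟫`.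

The threshold `θ = 1` is the self-similar rate (`ω ∼ (−t)^{−1}`, `∇v ∼ (−t)^{−1}`): in similarity variables the
`Ω₃`-equation carries the damping `+Ω₃`, and `θ < 1` is what lets the damping win.  Compare the FORWARD threshold for
`|ω|` (Chae 2010; tree `Literature.Analysis.FluidPDE.TypeIStretchingThreshold`, constant `1`); here: ANCIENT, ONE SIGNED
COMPONENT, no Beale–Kato–Majda.

Seat ns-hsw-p1 g2 (LEAD of 25311, cell pub-ns-dss).  WHAT THIS IS NOT: not a statement about Navier–Stokes regularity;
the door statements are regularity CRITERIA about HYPOTHETICAL blow-up profiles (KNSS ancient mild solutions); this is a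
stratum of the open stub (helper `--supports` 25311), not its closure.
-/

noncomputable section

-- the summit and its single sub-problem share the name (CONVENTIONS §1), as in every Theorems file
set_option linter.dupNamespace false

namespace Summit.NavierStokesRegularity.NavierStokesRegularity.Theorems.HalfSpaceWindowDoorCirculationCarryingRigiditySubcriticalStretching

open Set Function Filter Topology
open scoped RealInnerProductSpace InnerProductSpace Laplacian ContDiff
open Literature.Analysis Literature.Analysis.FluidPDE
open Summit.NavierStokesRegularity.NavierStokesRegularity.Theorems.HalfSpaceWindowDoorCirculationCarryingRigidityDefs
open Summit.NavierStokesRegularity.NavierStokesRegularity.Theorems.ChiralWindowDoorClassDerivDecay (exists_classical_of_class)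
open Summit.NavierStokesRegularity.NavierStokesRegularity.Theorems.CorkscrewProfile.Birth (stub_ancientSubsolutionNonpos)
open Summit.NavierStokesRegularity.NavierStokesRegularity.Theorems.PoloidalWindowDoorPoloidalWindowRigidityClassSpaceTimeRates
  (exists_fderiv_rate_of_class')

variable {v : ℝ → EuclideanSpace ℝ (Fin 3) → EuclideanSpace ℝ (Fin 3)}

/-! ### The `e₃`-component of the vorticity equation -/

/-- `⟪a, e₃⟫ ≤ ‖a‖` (Cauchy–Schwarz with `‖e₃‖ = 1`). -/
theorem inner_e3_le_norm (a : EuclideanSpace ℝ (Fin 3)) : ⟪a, e3⟫ ≤ ‖a‖ := by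
  have h := real_inner_le_norm a e3
  have hn : ‖e3‖ = 1 := by rw [e3, PiLp.norm_single, norm_one]
  rwa [hn, mul_one] at h

/-- Spatial derivative of the `e₃`-component of a differentiable field: `D⟪W, e₃⟫(y) h = ⟪DW(y) h, e₃⟫`. [folklore] -/
theorem fderiv_inner_e3_apply {W : EuclideanSpace ℝ (Fin 3) → EuclideanSpace ℝ (Fin 3)} {y : EuclideanSpace ℝ (Fin 3)}
    (hW : DifferentiableAt ℝ W y) (h : EuclideanSpace ℝ (Fin 3)) :
    fderiv ℝ (fun z => ⟪W z, e3⟫) y h = ⟪fderiv ℝ W y h, e3⟫ := by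
  rw [fderiv_inner_apply ℝ hW (differentiableAt_const e3)]
  simp

/-- Laplacian of the `e₃`-component of a `C²` field: `Δ⟪W, e₃⟫ = ⟪ΔW, e₃⟫`. [folklore] -/
theorem laplacian_inner_e3 {W : EuclideanSpace ℝ (Fin 3) → EuclideanSpace ℝ (Fin 3)} (hW : ContDiff ℝ 2 W)
    (y : EuclideanSpace ℝ (Fin 3)) : (Δ fun z => ⟪W z, e3⟫) y = ⟪(Δ W) y, e3⟫ := by
  have h : (fun z => ⟪W z, e3⟫) = fun z => ⟪e3, W z⟫ := funext fun z => real_inner_comm _ _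
  rw [h, laplacian_inner_const_left hW e3 y, real_inner_comm]

/-- **The `e₃`-component of the vorticity equation.**  For a solution `v` of the vorticity formulation (unit
viscosity) on `(−∞,0)`, `ω₃(t,y) = ⟪curl v(t)(y), e₃⟫` satisfies
`∂ₜω₃ = Δω₃ − Dω₃[v] + ⟪Dv[ω], e₃⟫` pointwise (`⟪(v·∇)ω, e₃⟫ = Dω₃[v]`, `⟪Δω, e₃⟫ = Δω₃`, and the stretching
`⟪(ω·∇)v, e₃⟫ = (ω·∇)v₃` stays as the source). [cite: MajdaBertozziCUP2002, Prop. 2.4 eq. (2.110); folklore] -/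
theorem hasDerivAt_inner_curl_e3 (hV : IsVorticitySolutionOn (Iio (0 : ℝ)) 1 v) {t : ℝ} (ht : t < 0)
    (y : EuclideanSpace ℝ (Fin 3)) :
    HasDerivAt (fun s => ⟪curl (v s) y, e3⟫)
      ((Δ fun z => ⟪curl (v t) z, e3⟫) y - fderiv ℝ (fun z => ⟪curl (v t) z, e3⟫) y (v t y)
        + ⟪fderiv ℝ (v t) y (curl (v t) y), e3⟫) t := by
  have hS : IsOpen (Iio (0 : ℝ)) := isOpen_Iio
  have ht' : t ∈ Iio (0 : ℝ) := ht
  have hω : IsSmoothSpaceTimeOn (Iio (0 : ℝ)) (vorticity v) :=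
    hV.smooth_velocity.isSmoothSpaceTimeOn_vorticity hS.uniqueDiffOn
  have hωt : ContDiff ℝ ∞ (curl (v t)) := hω.contDiff_slice ht'
  have hω2 : ContDiff ℝ 2 (curl (v t)) := hωt.of_le (by norm_cast)
  have hωd : Differentiable ℝ (curl (v t)) := hω2.differentiable two_ne_zero
  -- the time line of `ω(·, y)` and of `ω₃(·, y)`
  have hline : HasDerivAt (fun s => curl (v s) y) (deriv (fun s => curl (v s) y) t) t :=
    hω.hasDerivAt_timeLine hS ht' y
  have h3line : HasDerivAt (fun s => ⟪curl (v s) y, e3⟫) (⟪deriv (fun s => curl (v s) y) t, e3⟫) t := by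
    have := hline.inner ℝ (hasDerivAt_const t e3)
    simpa using this
  -- the vorticity equation at `(t, y)`, dotted with `e₃`
  have heq := hV.vorticity_eq t ht' y
  rw [timeDerivWithin_eq_deriv hS ht', vorticity_apply, one_smul] at heq
  have heq' := congrArg (fun w : EuclideanSpace ℝ (Fin 3) => ⟪w, e3⟫) heq
  simp only [inner_add_left, convect_apply, vorticity_apply] at heq'
  have h2 : ⟪fderiv ℝ (curl (v t)) y (v t y), e3⟫ = fderiv ℝ (fun z => ⟪curl (v t) z, e3⟫) y (v t y) :=
    (fderiv_inner_e3_apply (hωd y) _).symm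
  have h4 : ⟪(Δ (curl (v t))) y, e3⟫ = (Δ fun z => ⟪curl (v t) z, e3⟫) y := (laplacian_inner_e3 hω2 y).symm
  rw [h2, h4] at heq'
  convert h3line using 1
  linarith

/-! ### The weight `(−t)^θ` -/

/-- `(t, y) ↦ (−t)^θ` is jointly smooth on `(−∞,0) × ℝ³`. [folklore] -/
theorem isSmoothSpaceTimeOn_rpow_neg (θ : ℝ) :
    IsSmoothSpaceTimeOn (Iio (0 : ℝ)) fun (t : ℝ) (_ : EuclideanSpace ℝ (Fin 3)) => (-t) ^ θ := by
  intro p hp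
  have hp1 : p.1 < 0 := (mem_prod.1 hp).1
  have hne : -p.1 ≠ 0 := by linarith
  have h1 : ContDiffAt ℝ ∞ (fun q : ℝ × EuclideanSpace ℝ (Fin 3) => -q.1) p := contDiff_fst.neg.contDiffAt
  exact ((Real.contDiffAt_rpow_const_of_ne (p := θ) hne).comp p h1).contDiffWithinAt

/-- `d/dt (−t)^θ = −θ (−t)^{θ−1}` for `t < 0`. [folklore] -/
theorem hasDerivAt_rpow_neg (θ : ℝ) {t : ℝ} (ht : t < 0) :
    HasDerivAt (fun s : ℝ => (-s) ^ θ) (-(θ * (-t) ^ (θ - 1))) t := by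
  have h := (hasDerivAt_neg' (x := t)).rpow_const (p := θ) (Or.inl (neg_ne_zero.2 ht.ne))
  convert h using 1
  ring

/-! ### Subcritical stretching kills the `e₃`-vorticity from above -/

/-- **One-sided Liouville under subcritical `e₃`-stretching (no sign hypothesis).**  Let `v` be a profile of the
route's Type-I ancient Oseen-mild class (rate `C`, continuity on the open slab, unit-viscosity Oseen–Duhamel identity,
divergence-free slices).  If for some `θ < 1` the `e₃`-stretching obeys
`(−s)·⟪Dv(s,y)[curl v(s,y)], e₃⟫ ≤ θ·⟪curl v(s,y), e₃⟫` for all `s < 0` and `y`, then `⟪curl v(s,y), e₃⟫ ≤ 0`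
everywhere.  Proof: the class is classical (`exists_classical_of_class`) hence a vorticity solution; by
`hasDerivAt_inner_curl_e3` the weighted component `w = (−s)^θ ω₃` satisfies `∂ₛw ≤ Δw − Dw[v]`; the drift is Type I and
`w ≤ 4K(−s)^{θ−1}` (class rate `‖∇v(s)‖ ≤ K/(−s)`, `|ω| ≤ 4‖∇v‖`), monotone and `→ 0` as `s → −∞` since `θ < 1`; the
tree's ancient-subsolution Liouville lemma (`stub_ancientSubsolutionNonpos`) gives `w ≤ 0`.
[cite: Lieberman1996, Ch. II Lemma 2.1 and Lemma 2.3; folklore] -/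
theorem inner_curl_e3_nonpos_of_subcritical_stretching {C : ℝ} (hrate : HasTypeITimeDecay C v)
    (hcont : ContinuousOn (uncurry v) (Iio (0 : ℝ) ×ˢ univ))
    (hmild : ∀ s t : ℝ, s < t → t < 0 → ∀ x,
      v t x = UnboundedOperators.heatExtension (v s) (t - s) x - oseenDuhamel 1 s v v t x)
    (hdiv : ∀ t < 0, VectorCalculus.IsDivFree (v t)) {θ : ℝ} (hθ : θ < 1)
    (hstretch : ∀ s < 0, ∀ y, (-s) * ⟪fderiv ℝ (v s) y (curl (v s) y), e3⟫ ≤ θ * ⟪curl (v s) y, e3⟫) :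
    ∀ s < 0, ∀ y, ⟪curl (v s) y, e3⟫ ≤ 0 := by
  -- (1) the class is classical, hence a vorticity solution on `(−∞,0)`
  obtain ⟨q, hcl⟩ := exists_classical_of_class hrate hcont hmild hdiv
  have hS : IsOpen (Iio (0 : ℝ)) := isOpen_Iio
  have hV : IsVorticitySolutionOn (Iio (0 : ℝ)) 1 v :=
    hcl.isVorticitySolutionOn_zero_force hS.uniqueDiffOn (by rw [interior_Iio]; exact subset_closure)
  have hω : IsSmoothSpaceTimeOn (Iio (0 : ℝ)) (vorticity v) :=
    hV.smooth_velocity.isSmoothSpaceTimeOn_vorticity hS.uniqueDiffOn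
  -- (2) the Type-I vorticity bound `|ω(s,y)| ≤ 4K/(−s)`
  obtain ⟨K, hK0, hK⟩ := exists_fderiv_rate_of_class' hrate hcont hmild
  have hω3 : ∀ s < 0, ∀ y, ⟪curl (v s) y, e3⟫ ≤ 4 * K / (-s) := by
    intro s hs y
    calc ⟪curl (v s) y, e3⟫ ≤ ‖curl (v s) y‖ := inner_e3_le_norm _
      _ ≤ 4 * ‖fderiv ℝ (v s) y‖ := norm_curl_le_four_mul (v s) y
      _ ≤ 4 * (K / (-s)) := by gcongr; exact hK s hs y
      _ = 4 * K / (-s) := by ring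
  -- (3) the weighted component `w = (−t)^θ ω₃`, its time derivative and the subsolution inequality
  set w : ℝ → EuclideanSpace ℝ (Fin 3) → ℝ := fun t y => (-t) ^ θ * ⟪curl (v t) y, e3⟫ with hw
  set wt : ℝ → EuclideanSpace ℝ (Fin 3) → ℝ := fun t y =>
    -(θ * (-t) ^ (θ - 1)) * ⟪curl (v t) y, e3⟫ +
      (-t) ^ θ * ((Δ fun z => ⟪curl (v t) z, e3⟫) y - fderiv ℝ (fun z => ⟪curl (v t) z, e3⟫) y (v t y)
        + ⟪fderiv ℝ (v t) y (curl (v t) y), e3⟫) with hwt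
  have hω3s : IsSmoothSpaceTimeOn (Iio (0 : ℝ)) fun t y => ⟪curl (v t) y, e3⟫ :=
    hω.inner (isSmoothSpaceTimeOn_const_time contDiff_const _)
  have hws : IsSmoothSpaceTimeOn (Iio (0 : ℝ)) w := (isSmoothSpaceTimeOn_rpow_neg θ).mul hω3s
  have hw2 : ∀ t < 0, ContDiff ℝ 2 (w t) := fun t ht => (hws.contDiff_slice ht).of_le (by norm_cast)
  have hwc : ContinuousOn (uncurry w) (Iio 0 ×ˢ univ) := hws.continuousOn
  have hwt' : ∀ t < 0, ∀ y, HasDerivAt (fun s => w s y) (wt t y) t := by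
    intro t ht y
    have h := (hasDerivAt_rpow_neg θ ht).fun_mul (hasDerivAt_inner_curl_e3 hV ht y)
    simpa only [hw, hwt] using h
  have hsub : ∀ t < 0, ∀ y, wt t y ≤ (Δ (w t)) y - fderiv ℝ (w t) y (v t y) := by
    intro t ht y
    have hmt : 0 < -t := neg_pos.2 ht
    have hωt2 : ContDiff ℝ 2 fun z => ⟪curl (v t) z, e3⟫ := (hω3s.contDiff_slice ht).of_le (by norm_cast)
    -- `Δ` and `D` of the weighted slice
    have hfun : w t = ((-t) ^ θ) • fun z => ⟪curl (v t) z, e3⟫ := by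
      funext z; simp only [hw, Pi.smul_apply, smul_eq_mul]
    have hΔ : (Δ (w t)) y = (-t) ^ θ * (Δ fun z => ⟪curl (v t) z, e3⟫) y := by
      rw [hfun, InnerProductSpace.laplacian_smul _ hωt2.contDiffAt, smul_eq_mul]
    have hD : fderiv ℝ (w t) y (v t y) = (-t) ^ θ * fderiv ℝ (fun z => ⟪curl (v t) z, e3⟫) y (v t y) := by
      rw [hfun, fderiv_const_smul (hωt2.differentiable two_ne_zero y)]
      simp only [FunLike.coe_smul, Pi.smul_apply, smul_eq_mul]
    -- the stretching hypothesis, weighted by `(−t)^{θ−1} > 0`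
    have hpow : (-t) ^ θ = (-t) ^ (θ - 1) * (-t) := by
      rw [Real.rpow_sub_one hmt.ne', div_mul_cancel₀ _ hmt.ne']
    have hpos : 0 < (-t) ^ (θ - 1) := Real.rpow_pos_of_pos hmt _
    have hkey : (-t) ^ θ * ⟪fderiv ℝ (v t) y (curl (v t) y), e3⟫ ≤ θ * (-t) ^ (θ - 1) * ⟪curl (v t) y, e3⟫ := by
      have h := mul_le_mul_of_nonneg_left (hstretch t ht y) hpos.le
      calc (-t) ^ θ * ⟪fderiv ℝ (v t) y (curl (v t) y), e3⟫
          = (-t) ^ (θ - 1) * ((-t) * ⟪fderiv ℝ (v t) y (curl (v t) y), e3⟫) := by rw [hpow]; ring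
        _ ≤ (-t) ^ (θ - 1) * (θ * ⟪curl (v t) y, e3⟫) := h
        _ = θ * (-t) ^ (θ - 1) * ⟪curl (v t) y, e3⟫ := by ring
    rw [hΔ, hD]
    simp only [hwt]
    nlinarith [hkey]
  -- (4) the Type-I drift and the decaying upper bound `w ≤ 4K(−t)^{θ−1}`
  have hdrift : ∀ t < 0, ∀ y, ‖v t y‖ ≤ C / Real.sqrt (-t) := fun t ht y => hrate t ht y
  set b : ℝ → ℝ := fun t => 4 * K * (-t) ^ (θ - 1) with hb
  have hbd : ∀ t < 0, ∀ y, w t y ≤ b t := by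
    intro t ht y
    have hmt : 0 < -t := neg_pos.2 ht
    have hpowpos : 0 < (-t) ^ θ := Real.rpow_pos_of_pos hmt _
    have hpow : (-t) ^ θ = (-t) ^ (θ - 1) * (-t) := by
      rw [Real.rpow_sub_one hmt.ne', div_mul_cancel₀ _ hmt.ne']
    simp only [hw, hb]
    calc (-t) ^ θ * ⟪curl (v t) y, e3⟫ ≤ (-t) ^ θ * (4 * K / (-t)) :=
          mul_le_mul_of_nonneg_left (hω3 t ht y) hpowpos.le
      _ = 4 * K * (-t) ^ (θ - 1) := by
          have htne : t ≠ 0 := ht.ne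
          rw [hpow]; field_simp
  have hbmono : MonotoneOn b (Iio 0) := by
    intro s hs t ht hst
    have hs' : 0 < -s := neg_pos.2 hs
    have ht' : 0 < -t := neg_pos.2 ht
    simp only [hb]
    refine mul_le_mul_of_nonneg_left ?_ (by positivity)
    exact Real.rpow_le_rpow_of_nonpos ht' (by linarith) (by linarith)
  have hb0 : Tendsto b atBot (nhds 0) := by
    have h1 : Tendsto (fun t : ℝ => (-t) ^ (-(1 - θ))) atBot (nhds 0) :=
      (tendsto_rpow_neg_atTop (by linarith : 0 < 1 - θ)).comp tendsto_neg_atBot_atTop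
    have h2 : Tendsto (fun t : ℝ => 4 * K * (-t) ^ (-(1 - θ))) atBot (nhds (4 * K * 0)) := h1.const_mul _
    rw [mul_zero] at h2
    refine h2.congr fun t => ?_
    simp only [hb]
    rw [show -(1 - θ) = θ - 1 by ring]
  -- (5) the ancient-subsolution Liouville lemma
  have hle := stub_ancientSubsolutionNonpos hw2 hwc hwt' hsub hdrift hbd hbmono hb0
  intro s hs y
  have h := hle s hs y
  have hpos : 0 < (-s) ^ θ := Real.rpow_pos_of_pos (neg_pos.2 hs) _
  simp only [hw] at h
  by_contra hcon
  push Not at hcon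
  have : 0 < (-s) ^ θ * ⟪curl (v s) y, e3⟫ := mul_pos hpos hcon
  linarith

/-- **SUBCRITICAL `e₃`-STRETCHING EXCLUSION (stratum of the open stub `StubLayerExclusion ≡ HemisphereLiouvilleE3`).**
A CLOSED-HEMISPHERE profile of the route's Type-I ancient Oseen-mild class (`⟪curl v(s), e₃⟫ ≥ 0` everywhere) whose
`e₃`-vorticity is stretched below the similarity rate — `(−s)·⟪Dv(s,y)[curl v(s,y)], e₃⟫ ≤ θ·⟪curl v(s,y), e₃⟫` for
some `θ < 1` and all `s < 0`, `y` — is poloidal along `e₃`: `⟪curl v, e₃⟫ ≡ 0`.  (`θ = 1` is the self-similar rate;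
the research content of 25311 is exactly the stratum where the `e₃`-stretching reaches that rate.)
[cite: Lieberman1996, Ch. II Lemma 2.1 and Lemma 2.3; folklore] -/
theorem inner_curl_e3_eq_zero_of_subcritical_stretching :
    ∀ (C : ℝ) (v : ℝ → EuclideanSpace ℝ (Fin 3) → EuclideanSpace ℝ (Fin 3)),
    Literature.Analysis.FluidPDE.HasTypeITimeDecay C v →
    ContinuousOn (Function.uncurry v) (Set.Iio (0 : ℝ) ×ˢ Set.univ) →
    (∀ s t : ℝ, s < t → t < 0 → ∀ x, v t x =
      Literature.Analysis.UnboundedOperators.heatExtension (v s) (t - s) x -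
        Literature.Analysis.FluidPDE.oseenDuhamel 1 s v v t x) →
    (∀ t < 0, Literature.Analysis.FluidPDE.VectorCalculus.IsDivFree (v t)) →
    (∀ s < 0, ∀ y, 0 ≤ ⟪Literature.Analysis.FluidPDE.curl (v s) y, e3⟫_ℝ) →
    ∀ θ : ℝ, θ < 1 →
    (∀ s < 0, ∀ y, (-s) * ⟪fderiv ℝ (v s) y (Literature.Analysis.FluidPDE.curl (v s) y), e3⟫_ℝ ≤
      θ * ⟪Literature.Analysis.FluidPDE.curl (v s) y, e3⟫_ℝ) →
    ∀ s < 0, ∀ y, ⟪Literature.Analysis.FluidPDE.curl (v s) y, e3⟫_ℝ = 0 := by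
  intro C v hrate hcont hmild hdiv hnn θ hθ hstretch s hs y
  exact le_antisymm (inner_curl_e3_nonpos_of_subcritical_stretching hrate hcont hmild hdiv hθ hstretch s hs y)
    (hnn s hs y)

/-- **Census form (contrapositive): circulation-carrying closed-hemisphere profiles stretch at the similarity rate.**
If a closed-hemisphere profile of the class has `⟪curl v(s₀,y₀), e₃⟫ > 0` at one point, then for every `θ < 1`
there is a point `(s, y)`, `s < 0`, where `θ·⟪curl v(s,y), e₃⟫ < (−s)·⟪Dv(s,y)[curl v(s,y)], e₃⟫` — the
`e₃`-vorticity is stretched faster than `θ/(−s)` (and there `⟪curl v(s,y), e₃⟫ > 0` or the stretching is positive).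
[cite: Lieberman1996, Ch. II Lemma 2.1 and Lemma 2.3; folklore] -/
theorem exists_supercritical_stretching_of_pos {C : ℝ} (hrate : HasTypeITimeDecay C v)
    (hcont : ContinuousOn (uncurry v) (Iio (0 : ℝ) ×ˢ univ))
    (hmild : ∀ s t : ℝ, s < t → t < 0 → ∀ x,
      v t x = UnboundedOperators.heatExtension (v s) (t - s) x - oseenDuhamel 1 s v v t x)
    (hdiv : ∀ t < 0, VectorCalculus.IsDivFree (v t))
    (hnn : ∀ s < 0, ∀ y, 0 ≤ ⟪curl (v s) y, e3⟫) {s₀ : ℝ} (hs₀ : s₀ < 0) {y₀ : EuclideanSpace ℝ (Fin 3)}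
    (hpos : 0 < ⟪curl (v s₀) y₀, e3⟫) {θ : ℝ} (hθ : θ < 1) :
    ∃ s : ℝ, s < 0 ∧ ∃ y, θ * ⟪curl (v s) y, e3⟫ < (-s) * ⟪fderiv ℝ (v s) y (curl (v s) y), e3⟫ := by
  by_contra hcon
  push Not at hcon
  have h := inner_curl_e3_eq_zero_of_subcritical_stretching C v hrate hcont hmild hdiv hnn θ hθ
    (fun s hs y => hcon s hs y) s₀ hs₀ y₀
  linarith

end Summit.NavierStokesRegularity.NavierStokesRegularity.Theorems.HalfSpaceWindowDoorCirculationCarryingRigiditySubcriticalStretching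

end
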